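import Summits.NavierStokesRegularity.FluidComputer.DampedTransitionFire

/-!
# Tao's delay gate under NON-UNIFORM diagonal damping, part 6: (atc) and the `E_*`-dissipation

Companion of `DampedTransition{,Quiet,Window,Fire}.lean` (cell `pub-fluidc`, seat bp1). HONEST FRAMING
(verbatim): low prior, high value-of-information experiment on Tao's machine paradigm; NOT a claim that NS blows
up. Five-mode truncation (5.5) of [Tao2016AveragedNS, §5.5] with a diagonal damping `-E(t) * X(t)`,
`0 ≤ Eᵢ(t) ≤ η ≤ 1/100`, on `[0,2]`; nothing is proved about Navier–Stokes.

Second file of the FIRING phase (bp1 item S1b; plan `pub-fluidc-bp1/PLAN-S1b-firing-damped.md`):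
* `sum_sq_sandwich` — the structural replacement (R1) for (energy-con): `1 - 2ηt ≤ Σ Xᵢ² ≤ 1` on `[0,2]`;
* `e_tenth` — **(atc)**, damped and slightly STRONGER: `ã(t_c + δ + 1/K) ≥ 11/100` (the extra `1/100` pays
  for the decay `ã(s) ≥ e^{-η(s-t')}ã(t')` later, so that `ã ≥ 1/10` on all of `[t', 2]`); the proof is Tao's
  (`Ψ = V + 2ã/K` has `∂ₜΨ ≥ 0.93` on `J = [σ, σ + 1/K]` if `ã(σ + 1/K) < 0.11`, total variation `O(1/K)`),
  with `e^{ηt}ã` monotone in place of `ã` monotone and the sandwich in place of `Σ Xᵢ² = 1`;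
* `Es_alg_damped`, `hasDerivAt_Es`, `Es_dissipation` — the modified energy is now
  `E_* = ½(a² + b² + c² + d²) - ½K·V·ã` (NOT `½(1 - ã²) - …`: the two differ under damping), and
  `∂ₜE_* + (K/10)E_* ≤ 7K⁻⁸⁹` on `[t', 2]` — the damping only ADDS dissipation `-Σ_{i<4} EᵢXᵢ² ≤ 0`;
Not here: `KVe_small`, (toke) `Es_decay`, (beable), the assembled `firingPhase` — file 7.
[cite: Tao2016AveragedNS, §5.5 Thm 5.3 proof: (atc), (douse), proof of (beable)]. No named facts; 0 sorry.
-/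

noncomputable section

namespace Summit.NavierStokesRegularity.FluidComputer

open Real Set Filter Topology
open Literature.Analysis.FluidPDE.Tao2016AveragedNS
open Literature.Analysis.FluidPDE.Tao2016AveragedNS.Thm53 (monotoneOn_sub_of_le_deriv invSqrt_facts)

namespace DampedTransition

section PhaseThree

variable {K M ε η τ δ : ℝ} {E X : ℝ → Fin 5 → ℝ}

/-- (R1) the energy sandwich under damping: `1 - 2ηt ≤ a² + b² + c² + d² + ã² ≤ 1` on `[0,2]`
(`energy_ge_exp`, `energy_le_one`, `e^{-x} ≥ 1 - x`). [cite: Tao2016AveragedNS, §5.5 (energy-con)] -/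
theorem sum_sq_sandwich
    (hX : ∀ t ∈ Icc (0:ℝ) 2, HasDerivAt X (delayCircuitWith K M ε (X t) - E t * X t) t)
    (hE : ∀ t ∈ Icc (0:ℝ) 2, ∀ i, 0 ≤ E t i ∧ E t i ≤ η) (h0 : X 0 = delayInit)
    {t : ℝ} (ht : t ∈ Icc (0:ℝ) 2) :
    1 - 2 * η * t ≤ X t 0 ^ 2 + X t 1 ^ 2 + X t 2 ^ 2 + X t 3 ^ 2 + X t 4 ^ 2 ∧
      X t 0 ^ 2 + X t 1 ^ 2 + X t 2 ^ 2 + X t 3 ^ 2 + X t 4 ^ 2 ≤ 1 := by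
  have h1 := energy_ge_exp hX hE h0 ht
  have h2 := energy_le_one hX hE h0 ht
  simp only [energy, Fin.sum_univ_five] at h1 h2
  refine ⟨le_trans ?_ h1, h2⟩
  have := add_one_le_exp (-(2 * η * t))
  linarith

/-- **(atc), damped**, with onset `σ = t_c + δ`: `ã(σ + 1/K) ≥ 11/100`. If not, on `J = [σ, σ + 1/K]`:
`ã ≤ (50/49)·0.11 ≤ 3/25` (by `e^{ηt}ã` non-decreasing), so `a² + d² ≥ 0.96 - 0.002 - 0.0144` (sandwich),
while `Ψ = V + 2ã/K` has `∂ₜΨ = a² + d² + R - (2/K)E₄ã ≥ 0.93` and total variation `≤ 2K⁻¹⁰⁰ + 0.22/K`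
over `J` — a contradiction. [cite: Tao2016AveragedNS, §5.5 (atc)] -/
theorem e_tenth
    (hX : ∀ t ∈ Icc (0:ℝ) 2, HasDerivAt X (delayCircuitWith K M ε (X t) - E t * X t) t)
    (hE : ∀ t ∈ Icc (0:ℝ) 2, ∀ i, 0 ≤ E t i ∧ E t i ≤ η) (h0 : X 0 = delayInit)
    (hε : 0 < ε) (hε1 : ε ≤ 1) (hM0 : 0 < M) (hMK : M ≤ K ^ 10) (hK : 16 ≤ K) (hεK : ε ^ 2 ≤ 1 / (6 * K ^ 20))
    (hεexp : ε ^ 2 ≤ exp (-(18 * M)) / (64 * M)) (hη : η ≤ 1 / 100)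
    (hδ : 0 ≤ δ) (hon : K ^ 111 ≤ exp (M * δ / 8))
    (hτ1 : 1 ≤ τ) (hfit : τ + δ + (sqrt K)⁻¹ ≤ 2)
    (hcτ : ∀ t, 0 ≤ t → t ≤ τ → X t 2 ≤ ε ^ 2 / K ^ 10) (hcτeq : X τ 2 = ε ^ 2 / K ^ 10) :
    11 / 100 ≤ X (τ + δ + K⁻¹) 4 := by
  have hK0 : 0 < K := by linarith
  have hK1 : 1 ≤ K := by linarith
  have hη0 : 0 ≤ η := (hE 0 ⟨le_rfl, zero_le_two⟩ 0).1.trans (hE 0 ⟨le_rfl, zero_le_two⟩ 0).2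
  have hsK : K⁻¹ ≤ (sqrt K)⁻¹ := by
    rw [inv_le_inv₀ hK0 (by positivity)]
    calc sqrt K ≤ sqrt K * sqrt K :=
          le_mul_of_one_le_right (by positivity) (by linarith [(invSqrt_facts hK).2.2.2.1])
      _ = K := mul_self_sqrt hK0.le
  have hu0' : 0 < K⁻¹ := inv_pos.2 hK0
  have hτ2 : τ ≤ 2 := by linarith
  set t₀ : ℝ := τ + δ with ht₀
  set t₁ : ℝ := τ + δ + K⁻¹ with ht₁
  have ht₀0 : 0 ≤ t₀ := by simp only [ht₀]; linarith
  have h01 : t₀ ≤ t₁ := by simp only [ht₀, ht₁]; linarith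
  have ht12 : t₁ ≤ 2 := by simp only [ht₁]; linarith
  have ht₁02 : t₁ ∈ Icc (0:ℝ) 2 := ⟨by linarith, ht12⟩
  have hJI : ∀ s ∈ Icc t₀ t₁, s ∈ Icc (τ + δ) 2 := fun s hs => ⟨hs.1, hs.2.trans ht12⟩
  have hK20 : (2 : ℝ) ^ 20 ≤ K ^ 20 := pow_le_pow_left₀ (by norm_num) (by linarith) 20
  have hK90 : (2 : ℝ) ^ 90 ≤ K ^ 90 := pow_le_pow_left₀ (by norm_num) (by linarith) 90
  have hε2 : (5 * ε) ^ 2 ≤ 1 / 1000 := by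
    have h6 : 1 / (6 * K ^ 20) ≤ 1 / 25000 := by
      apply one_div_le_one_div_of_le (by norm_num); linarith
    have : (5 * ε) ^ 2 = 25 * ε ^ 2 := by ring
    rw [this]; linarith
  have hK90' : 9 / K ^ 90 ≤ 1 / 1000 := by
    rw [div_le_div_iff₀ (by positivity) (by norm_num)]; linarith
  by_contra hlt'
  have hlt := not_le.1 hlt'
  have hmonoE := output_mul_exp_monotoneOn hX hE h0 hK0.le
  have hes : ∀ s ∈ Icc t₀ t₁, X s 4 ≤ 3 / 25 := by
    intro s hs
    have hs02 : s ∈ Icc (0:ℝ) 2 := ⟨by linarith [hs.1], (hJI s hs).2⟩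
    have hm := hmonoE hs02 ht₁02 hs.2
    simp only at hm
    have hx0 : 0 ≤ η * (t₁ - s) := mul_nonneg hη0 (by linarith [hs.2])
    have hx1 : η * (t₁ - s) ≤ 1 / 50 := by
      calc η * (t₁ - s) ≤ 1 / 100 * 2 := mul_le_mul hη (by linarith [hs02.1]) (by linarith [hs.2])
            (by norm_num)
        _ = 1 / 50 := by norm_num
    have hex : exp (η * (t₁ - s)) ≤ 50 / 49 := by
      calc exp (η * (t₁ - s)) ≤ 1 / (1 - η * (t₁ - s)) :=
            Real.exp_bound_div_one_sub_of_interval hx0 (by linarith)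
        _ ≤ 50 / 49 := by rw [div_le_div_iff₀ (by linarith) (by norm_num)]; linarith
    have h2 : exp (η * t₁) = exp (η * s) * exp (η * (t₁ - s)) := by rw [← exp_add]; ring_nf
    have h3 : X t₁ 4 * exp (η * t₁) ≤ 11 / 100 * (exp (η * s) * (50 / 49)) := by
      rw [h2]
      calc X t₁ 4 * (exp (η * s) * exp (η * (t₁ - s)))
          ≤ 11 / 100 * (exp (η * s) * exp (η * (t₁ - s))) :=
            mul_le_mul_of_nonneg_right hlt.le (by positivity)
        _ ≤ 11 / 100 * (exp (η * s) * (50 / 49)) :=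
            mul_le_mul_of_nonneg_left (mul_le_mul_of_nonneg_left hex (exp_pos _).le) (by norm_num)
    have h4 : X s 4 * exp (η * s) ≤ 3 / 25 * exp (η * s) := by linarith [exp_pos (η * s)]
    exact le_of_mul_le_mul_right h4 (exp_pos _)
  have hmono := monotoneOn_sub_of_le_deriv (φ := fun _ => (93 : ℝ) / 100)
    (Φ := fun s => 93 / 100 * s) (convex_Icc t₀ t₁)
    (f := fun s => X s 0 * X s 3 * (ε ^ 2 * (X s 2)⁻¹) + 2 / K * X s 4)
    (fun s hs => by
      have hsI := hJI s hs
      have hs02 : s ∈ Icc (0:ℝ) 2 := ⟨by linarith [hs.1], hsI.2⟩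
      have hcl : K ^ 100 * ε ^ 2 ≤ X s 2 :=
        c_large hX hE h0 hε hε1 hM0 hMK hK hεK hεexp hη hδ hon hτ1 hτ2 hcτ hcτeq hsI
      have hcne : X s 2 ≠ 0 := (lt_of_lt_of_le (by positivity) hcl).ne'
      exact (hasDerivAt_V (hX s hs02) hε.ne' hcne).add ((hasDerivAt_e (hX s hs02)).const_mul (2 / K)))
    (fun s _ => ((hasDerivAt_id s).const_mul ((93 : ℝ) / 100)).congr_deriv (by simp))
    (fun s hs => by
      have hsI := hJI s hs
      have hs02 : s ∈ Icc (0 : ℝ) 2 := ⟨by linarith [hs.1, ht₀0], hsI.2⟩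
      have hR := V_remainder_le hX hE h0 hε hε1 hM0 hMK hK hεK hεexp hη hδ hon hτ1 hτ2 hcτ hcτeq hsI
      have hRlo := (abs_le.1 hR).1
      obtain ⟨hSlo, -⟩ := sum_sq_sandwich hX hE h0 hs02
      have hS96 : 24 / 25 ≤ X s 0 ^ 2 + X s 1 ^ 2 + X s 2 ^ 2 + X s 3 ^ 2 + X s 4 ^ 2 := by
        have : 2 * η * s ≤ 2 * (1 / 100) * 2 :=
          mul_le_mul (mul_le_mul_of_nonneg_left hη (by norm_num)) hs02.2 hs02.1 (by norm_num)
        linarith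
      obtain ⟨hb5, hc5⟩ := bc_small hX hE h0 hε hε1 hM0.le hs02
      have hb2 : X s 1 ^ 2 ≤ (5 * ε) ^ 2 := by
        rw [← sq_abs]; exact pow_le_pow_left₀ (abs_nonneg _) hb5 2
      have hc2 : X s 2 ^ 2 ≤ (5 * ε) ^ 2 := by
        rw [← sq_abs]; exact pow_le_pow_left₀ (abs_nonneg _) hc5 2
      have hes0 : 0 ≤ X s 4 := e_nonneg hX hE h0 hK0.le hs02
      have he2 : X s 4 ^ 2 ≤ (3 / 25) ^ 2 := pow_le_pow_left₀ hes0 (hes s hs) 2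
      have hE4 := hE s hs02 4
      have he1 : X s 4 ≤ 1 := (le_abs_self _).trans (traj_abs_le_one hX hE h0 hs02 4)
      have hp : E s 4 * X s 4 ≤ 1 / 100 := by
        calc E s 4 * X s 4 ≤ η * 1 := mul_le_mul hE4.2 he1 hes0 hη0
          _ ≤ 1 / 100 := by linarith
      have hp0 : 0 ≤ E s 4 * X s 4 := mul_nonneg hE4.1 hes0
      have h2K : 2 / K ≤ 1 / 8 := by rw [div_le_iff₀ hK0]; linarith
      have hEe : 2 / K * (E s 4 * X s 4) ≤ 1 / 8 * (1 / 100) := mul_le_mul h2K hp hp0 (by norm_num)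
      have hKd : 2 / K * (K * X s 3 ^ 2 - E s 4 * X s 4) = 2 * X s 3 ^ 2 - 2 / K * (E s 4 * X s 4) := by
        have : (2:ℝ) / K * K = 2 := div_mul_cancel₀ 2 hK0.ne'
        rw [mul_sub, ← mul_assoc, this]
      rw [hKd]
      norm_num at he2 ⊢
      linarith)
  have hmem0 : t₀ ∈ Icc t₀ t₁ := ⟨le_rfl, h01⟩
  have hmem1 : t₁ ∈ Icc t₀ t₁ := ⟨h01, le_rfl⟩
  have h := hmono hmem0 hmem1 h01
  simp only at h
  have hV : ∀ s ∈ Icc t₀ t₁, |X s 0 * X s 3 * (ε ^ 2 * (X s 2)⁻¹)| ≤ 1 / K ^ 100 := by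
    intro s hs
    have hsI := hJI s hs
    have hs02 : s ∈ Icc (0:ℝ) 2 := ⟨by linarith [hs.1], hsI.2⟩
    have hcl : K ^ 100 * ε ^ 2 ≤ X s 2 :=
      c_large hX hE h0 hε hε1 hM0 hMK hK hεK hεexp hη hδ hon hτ1 hτ2 hcτ hcτeq hsI
    have hcpos : 0 < X s 2 := lt_of_lt_of_le (by positivity) hcl
    have hq0 : 0 ≤ ε ^ 2 * (X s 2)⁻¹ := by positivity
    have hq : ε ^ 2 * (X s 2)⁻¹ ≤ 1 / K ^ 100 := by
      rw [← div_eq_mul_inv, div_le_div_iff₀ hcpos (by positivity), one_mul]; linarith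
    rw [abs_mul, abs_mul, abs_of_nonneg hq0]
    calc |X s 0| * |X s 3| * (ε ^ 2 * (X s 2)⁻¹) ≤ 1 * 1 * (1 / K ^ 100) :=
          mul_le_mul (mul_le_mul (traj_abs_le_one hX hE h0 hs02 0) (traj_abs_le_one hX hE h0 hs02 3)
            (abs_nonneg _) zero_le_one) hq hq0 (by norm_num)
      _ = 1 / K ^ 100 := by ring
  have hV0 := (abs_le.1 (hV t₀ hmem0)).1
  have hV1 := (abs_le.1 (hV t₁ hmem1)).2
  have he0 : 0 ≤ X t₀ 4 := e_nonneg hX hE h0 hK0.le ⟨ht₀0, h01.trans ht12⟩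
  have hlen : t₁ - t₀ = K⁻¹ := by simp only [ht₀, ht₁]; ring
  set u : ℝ := K⁻¹ with hu
  have hu0 : 0 < u := by positivity
  have hK8 : (2 : ℝ) ^ 8 ≤ K ^ 8 := pow_le_pow_left₀ (by norm_num) (by linarith) 8
  have hK99 : (2 : ℝ) ^ 8 ≤ K ^ 99 := hK8.trans (pow_le_pow_right₀ hK1 (by norm_num))
  have hi99 : (K ^ 99)⁻¹ ≤ 1 / 256 := by
    rw [one_div, inv_le_inv₀ (by positivity) (by norm_num)]; linarith
  have h100 : 1 / K ^ 100 ≤ u * (1 / 256) := by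
    rw [show 1 / K ^ 100 = u * (K ^ 99)⁻¹ by
      simp only [hu]; rw [← mul_inv, ← pow_succ', one_div]]
    exact mul_le_mul_of_nonneg_left hi99 hu0.le
  have hKu : 2 / K * X t₁ 4 - 2 / K * X t₀ 4 ≤ 2 * u * (11 / 100) := by
    have : 2 / K * X t₁ 4 - 2 / K * X t₀ 4 = 2 * u * (X t₁ 4 - X t₀ 4) := by
      simp only [hu]; ring
    rw [this]
    exact mul_le_mul_of_nonneg_left (by linarith) (by positivity)
  have hfin : 93 / 100 * (t₁ - t₀) ≤ 2 * (u * (1 / 256)) + 2 * u * (11 / 100) := by linarith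
  rw [hlen] at hfin
  linarith

/-! ## The modified energy `E_* = ½(a² + b² + c² + d²) - ½K·V·ã` and its dissipation -/

/-- **The `E_*`-dissipation algebra under damping.** With `|a|, |d|, |ã| ≤ 1`, `ã ≥ 1/10`,
`b², c² ≤ 25ε²`, `0 ≤ q ≤ K⁻¹⁰⁰` (`V = adq`), `|R| ≤ 9K⁻⁹⁰`, `ε ≤ K⁻¹⁰⁰`, an extra dissipation `D ≥ 0`
and an output rate `0 ≤ E₄ ≤ 1/100`:
`-Kãd² - D - ½K((a² - d² + R)ã + V(Kd² - E₄ã)) + (K/10)(½(a²+b²+c²+d²) - ½KVã) ≤ 7K⁻⁸⁹`.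
[cite: Tao2016AveragedNS, §5.5 (proof of (beable))] -/
theorem Es_alg_damped {K ε a b c d e q R D E₄ : ℝ} (hK : 16 ≤ K)
    (hq0 : 0 ≤ q) (hq1 : q ≤ 1 / K ^ 100) (hR : |R| ≤ 9 / K ^ 90)
    (ha : |a| ≤ 1) (hd : |d| ≤ 1) (he1 : |e| ≤ 1) (he : 1 / 10 ≤ e)
    (hb2 : b ^ 2 ≤ (5 * ε) ^ 2) (hc2 : c ^ 2 ≤ (5 * ε) ^ 2) (hε : 0 < ε) (hε100 : ε ≤ 1 / K ^ 100)
    (hD : 0 ≤ D) (hE₄ : 0 ≤ E₄) (hE₄' : E₄ ≤ 1 / 100) :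
    -(K * e * d ^ 2) - D - K / 2 * (((a ^ 2 - d ^ 2) + R) * e + a * d * q * (K * d ^ 2 - E₄ * e))
      + K / 10 * ((a ^ 2 + b ^ 2 + c ^ 2 + d ^ 2) / 2 - K / 2 * (a * d * q * e)) ≤ 7 / K ^ 89 := by
  have hK0 : 0 < K := by linarith
  have hK1 : 1 ≤ K := by linarith
  have key : -(K * e * d ^ 2) - D - K / 2 * (((a ^ 2 - d ^ 2) + R) * e + a * d * q * (K * d ^ 2 - E₄ * e))
      + K / 10 * ((a ^ 2 + b ^ 2 + c ^ 2 + d ^ 2) / 2 - K / 2 * (a * d * q * e))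
      = K / 2 * (a ^ 2 + d ^ 2) * (1 / 10 - e) - D + K / 20 * (b ^ 2 + c ^ 2) - K / 2 * R * e
        - K ^ 2 / 2 * (a * d * q) * d ^ 2 + K / 2 * (a * d * q) * E₄ * e
        - K ^ 2 / 20 * (a * d * q) * e := by ring
  rw [key]
  set w : ℝ := 1 / K ^ 100 with hw
  have hw0 : 0 ≤ w := by positivity
  have e90 : 9 / K ^ 90 = 9 * K ^ 10 * w := by simp only [hw]; field_simp
  have e89 : 7 / K ^ 89 = 7 * K ^ 11 * w := by simp only [hw]; field_simp
  have hKp1 : K ≤ K ^ 11 := le_self_pow₀ hK1 (by norm_num)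
  have hKp2 : K ^ 2 ≤ K ^ 11 := pow_le_pow_right₀ hK1 (by norm_num)
  have hKp10 : (5:ℝ) ≤ K ^ 10 := le_trans (by linarith) (le_self_pow₀ hK1 (by norm_num) : K ≤ K ^ 10)
  have hK11 : K ^ 11 = K * K ^ 10 := by ring
  have hKw : K * w ≤ K ^ 11 * w := mul_le_mul_of_nonneg_right hKp1 hw0
  have hK2w : K ^ 2 * w ≤ K ^ 11 * w := mul_le_mul_of_nonneg_right hKp2 hw0
  have hK5w : 5 * K * w ≤ K ^ 11 * w := by
    refine mul_le_mul_of_nonneg_right ?_ hw0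
    rw [hK11]; linarith [mul_le_mul_of_nonneg_left hKp10 hK0.le]
  have hd2 : d ^ 2 ≤ 1 := by rw [← sq_abs]; exact pow_le_one₀ (abs_nonneg d) hd
  have hKw0 : 0 ≤ K * w := mul_nonneg hK0.le hw0
  have hK2w0 : 0 ≤ K ^ 2 * w := mul_nonneg (sq_nonneg K) hw0
  have hB0 : 0 ≤ K ^ 11 * w := mul_nonneg (pow_nonneg hK0.le 11) hw0
  have hV : |a * d * q| ≤ w := by
    rw [abs_mul, abs_mul, abs_of_nonneg hq0]
    calc |a| * |d| * q ≤ 1 * 1 * w := by gcongr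
      _ = w := by ring
  have h1 : K / 2 * (a ^ 2 + d ^ 2) * (1 / 10 - e) ≤ 0 := by
    have := mul_nonneg (by positivity : 0 ≤ K / 2 * (a ^ 2 + d ^ 2)) (by linarith : 0 ≤ e - 1 / 10)
    linarith
  have hεw : ε ^ 2 ≤ w := by
    have hε1 : ε ≤ 1 := hε100.trans (by
      simp only [hw]; rw [div_le_one (by positivity)]; exact one_le_pow₀ hK1)
    calc ε ^ 2 = ε * ε := sq ε
      _ ≤ 1 * w := mul_le_mul hε1 hε100 hε.le zero_le_one
      _ = w := one_mul w
  have h3 : K / 20 * (b ^ 2 + c ^ 2) ≤ 1 / 2 * (K ^ 11 * w) := by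
    have : (5 * ε) ^ 2 = 25 * ε ^ 2 := by ring
    have hbc : b ^ 2 + c ^ 2 ≤ 50 * w := by linarith
    calc K / 20 * (b ^ 2 + c ^ 2) ≤ K / 20 * (50 * w) := mul_le_mul_of_nonneg_left hbc (by positivity)
      _ = 1 / 2 * (5 * K * w) := by ring
      _ ≤ 1 / 2 * (K ^ 11 * w) := by linarith
  have h4 : |K / 2 * R * e| ≤ 9 / 2 * (K ^ 11 * w) := by
    rw [abs_mul, abs_mul, abs_of_pos (by positivity : (0:ℝ) < K / 2)]
    calc K / 2 * |R| * |e| ≤ K / 2 * (9 * K ^ 10 * w) * 1 := by rw [← e90]; gcongr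
      _ = 9 / 2 * (K ^ 11 * w) := by ring
  have h5 : |K ^ 2 / 2 * (a * d * q) * d ^ 2| ≤ 1 / 2 * (K ^ 11 * w) := by
    rw [abs_mul, abs_mul, abs_of_pos (by positivity : (0:ℝ) < K ^ 2 / 2), abs_of_nonneg (sq_nonneg d)]
    calc K ^ 2 / 2 * |a * d * q| * d ^ 2 ≤ K ^ 2 / 2 * w * 1 := by gcongr
      _ = 1 / 2 * (K ^ 2 * w) := by ring
      _ ≤ 1 / 2 * (K ^ 11 * w) := by linarith
  have h6 : |K / 2 * (a * d * q) * E₄ * e| ≤ 1 / 2 * (K ^ 11 * w) := by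
    rw [abs_mul, abs_mul, abs_mul, abs_of_pos (by positivity : (0:ℝ) < K / 2), abs_of_nonneg hE₄]
    calc K / 2 * |a * d * q| * E₄ * |e| ≤ K / 2 * w * (1 / 100) * 1 := by gcongr
      _ ≤ 1 / 2 * (K * w) := by linarith
      _ ≤ 1 / 2 * (K ^ 11 * w) := by linarith
  have h7 : |K ^ 2 / 20 * (a * d * q) * e| ≤ 1 / 2 * (K ^ 11 * w) := by
    rw [abs_mul, abs_mul, abs_of_pos (by positivity : (0:ℝ) < K ^ 2 / 20)]
    calc K ^ 2 / 20 * |a * d * q| * |e| ≤ K ^ 2 / 20 * w * 1 := by gcongr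
      _ ≤ 1 / 2 * (K ^ 2 * w) := by linarith
      _ ≤ 1 / 2 * (K ^ 11 * w) := by linarith
  have h4' := (abs_le.1 h4).1
  have h5' := (abs_le.1 h5).1
  have h6' := (abs_le.1 h6).2
  have h7' := (abs_le.1 h7).1
  rw [e89]
  linarith

/-- Derivative of the modified energy `E_* = ½(a²+b²+c²+d²) - ½K·V·ã` along a damped trajectory:
`∂ₜE_* = -Kãd² - Σ_{i<4} EᵢXᵢ² - ½K(∂ₜV·ã + V·∂ₜã)`. [cite: Tao2016AveragedNS, §5.5 (proof of (beable))] -/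
theorem hasDerivAt_Es {t : ℝ} (hXt : HasDerivAt X (delayCircuitWith K M ε (X t) - E t * X t) t)
    (hε : ε ≠ 0) (hc : X t 2 ≠ 0) :
    HasDerivAt (fun s => (X s 0 ^ 2 + X s 1 ^ 2 + X s 2 ^ 2 + X s 3 ^ 2) / 2
        - K / 2 * (X s 0 * X s 3 * (ε ^ 2 * (X s 2)⁻¹) * X s 4))
      (-(K * X t 4 * X t 3 ^ 2)
        - (E t 0 * X t 0 ^ 2 + E t 1 * X t 1 ^ 2 + E t 2 * X t 2 ^ 2 + E t 3 * X t 3 ^ 2)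
        - K / 2 * (((X t 0 ^ 2 - X t 3 ^ 2) +
            ((-(ε * X t 0 * X t 1 * X t 3 + ε ^ 2 * exp (-M) * X t 0 * X t 2 * X t 3
                + K * X t 0 * X t 3 * X t 4) * (ε ^ 2 * (X t 2)⁻¹)
              - X t 0 * X t 3 * (ε ^ 2 * (X t 2)⁻¹) *
                ((ε ^ 2 * exp (-M) * X t 0 ^ 2 + ε⁻¹ * M * X t 1 * X t 2) * (X t 2)⁻¹))
              - (E t 0 + E t 3 - E t 2) * (X t 0 * X t 3 * (ε ^ 2 * (X t 2)⁻¹)))) * X t 4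
          + X t 0 * X t 3 * (ε ^ 2 * (X t 2)⁻¹) * (K * X t 3 ^ 2 - E t 4 * X t 4))) t := by
  have hS : HasDerivAt (fun s => (X s 0 ^ 2 + X s 1 ^ 2 + X s 2 ^ 2 + X s 3 ^ 2) / 2)
      (-(K * X t 4 * X t 3 ^ 2)
        - (E t 0 * X t 0 ^ 2 + E t 1 * X t 1 ^ 2 + E t 2 * X t 2 ^ 2 + E t 3 * X t 3 ^ 2)) t := by
    refine ((((((hasDerivAt_a hXt).fun_pow 2).fun_add ((hasDerivAt_b hXt).fun_pow 2)).fun_add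
      ((hasDerivAt_c hXt).fun_pow 2)).fun_add ((hasDerivAt_d hXt).fun_pow 2)).div_const 2).congr_deriv ?_
    simp only [show (2 : ℕ) - 1 = 1 from rfl, pow_one, Nat.cast_ofNat]
    field_simp
    ring
  have hVE := ((hasDerivAt_V hXt hε hc).fun_mul (hasDerivAt_e hXt)).const_mul (K / 2)
  exact (hS.fun_sub hVE).congr_deriv (by ring)

/-- **Dissipation inequality for `E_*` under damping** on `[t', 2]`, `t' = t_c + δ + 1/K`:
`∂ₜE_* + (K/10)E_* ≤ 7K⁻⁸⁹` (here `ã ≥ 1/10` on `[t', 2]` from (atc) `ã(t') ≥ 0.11` and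
`ã(s) ≥ e^{-η(s-t')}ã(t')`). [cite: Tao2016AveragedNS, §5.5 (proof of (beable))] -/
theorem Es_dissipation
    (hX : ∀ t ∈ Icc (0:ℝ) 2, HasDerivAt X (delayCircuitWith K M ε (X t) - E t * X t) t)
    (hE : ∀ t ∈ Icc (0:ℝ) 2, ∀ i, 0 ≤ E t i ∧ E t i ≤ η) (h0 : X 0 = delayInit)
    (hε : 0 < ε) (hε1 : ε ≤ 1) (hM0 : 0 < M) (hMK : M ≤ K ^ 10) (hK : 16 ≤ K) (hεK : ε ^ 2 ≤ 1 / (6 * K ^ 20))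
    (hε100 : ε ≤ 1 / K ^ 100) (hεexp : ε ^ 2 ≤ exp (-(18 * M)) / (64 * M)) (hη : η ≤ 1 / 100)
    (hδ : 0 ≤ δ) (hon : K ^ 111 ≤ exp (M * δ / 8))
    (hτ1 : 1 ≤ τ) (hfit : τ + δ + (sqrt K)⁻¹ ≤ 2)
    (hcτ : ∀ t, 0 ≤ t → t ≤ τ → X t 2 ≤ ε ^ 2 / K ^ 10) (hcτeq : X τ 2 = ε ^ 2 / K ^ 10)
    {s : ℝ} (hs : s ∈ Icc (τ + δ + K⁻¹) 2) :
    (-(K * X s 4 * X s 3 ^ 2)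
        - (E s 0 * X s 0 ^ 2 + E s 1 * X s 1 ^ 2 + E s 2 * X s 2 ^ 2 + E s 3 * X s 3 ^ 2)
        - K / 2 * (((X s 0 ^ 2 - X s 3 ^ 2) +
            ((-(ε * X s 0 * X s 1 * X s 3 + ε ^ 2 * exp (-M) * X s 0 * X s 2 * X s 3
                + K * X s 0 * X s 3 * X s 4) * (ε ^ 2 * (X s 2)⁻¹)
              - X s 0 * X s 3 * (ε ^ 2 * (X s 2)⁻¹) *
                ((ε ^ 2 * exp (-M) * X s 0 ^ 2 + ε⁻¹ * M * X s 1 * X s 2) * (X s 2)⁻¹))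
              - (E s 0 + E s 3 - E s 2) * (X s 0 * X s 3 * (ε ^ 2 * (X s 2)⁻¹)))) * X s 4
          + X s 0 * X s 3 * (ε ^ 2 * (X s 2)⁻¹) * (K * X s 3 ^ 2 - E s 4 * X s 4)))
      + K / 10 * ((X s 0 ^ 2 + X s 1 ^ 2 + X s 2 ^ 2 + X s 3 ^ 2) / 2
        - K / 2 * (X s 0 * X s 3 * (ε ^ 2 * (X s 2)⁻¹) * X s 4)) ≤ 7 / K ^ 89 := by
  have hK0 : 0 < K := by linarith
  have hK1 : 1 ≤ K := by linarith
  have hη0 : 0 ≤ η := (hE 0 ⟨le_rfl, zero_le_two⟩ 0).1.trans (hE 0 ⟨le_rfl, zero_le_two⟩ 0).2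
  have hu0' : 0 < K⁻¹ := inv_pos.2 hK0
  have hsK : K⁻¹ ≤ (sqrt K)⁻¹ := by
    rw [inv_le_inv₀ hK0 (by positivity)]
    calc sqrt K ≤ sqrt K * sqrt K :=
          le_mul_of_one_le_right (by positivity) (by linarith [(invSqrt_facts hK).2.2.2.1])
      _ = K := mul_self_sqrt hK0.le
  have hτ2 : τ ≤ 2 := by linarith
  have hsI : s ∈ Icc (τ + δ) 2 := ⟨by linarith [hs.1], hs.2⟩
  have hs02 : s ∈ Icc (0 : ℝ) 2 := ⟨by linarith [hs.1], hs.2⟩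
  have ht'02 : τ + δ + K⁻¹ ∈ Icc (0 : ℝ) 2 := ⟨by linarith, by linarith⟩
  have hcl : K ^ 100 * ε ^ 2 ≤ X s 2 :=
    c_large hX hE h0 hε hε1 hM0 hMK hK hεK hεexp hη hδ hon hτ1 hτ2 hcτ hcτeq hsI
  have hcpos : 0 < X s 2 := lt_of_lt_of_le (by positivity) hcl
  have hq0 : 0 ≤ ε ^ 2 * (X s 2)⁻¹ := by positivity
  have hq1 : ε ^ 2 * (X s 2)⁻¹ ≤ 1 / K ^ 100 := by
    rw [← div_eq_mul_inv, div_le_div_iff₀ hcpos (by positivity), one_mul]; linarith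
  obtain ⟨hb5, hc5⟩ := bc_small hX hE h0 hε hε1 hM0.le hs02
  have hb2 : X s 1 ^ 2 ≤ (5 * ε) ^ 2 := by
    rw [← sq_abs]; exact pow_le_pow_left₀ (abs_nonneg _) hb5 2
  have hc2 : X s 2 ^ 2 ≤ (5 * ε) ^ 2 := by
    rw [← sq_abs]; exact pow_le_pow_left₀ (abs_nonneg _) hc5 2
  -- `ã(s) ≥ 1/10`
  have he₀ : 11 / 100 ≤ X (τ + δ + K⁻¹) 4 :=
    e_tenth hX hE h0 hε hε1 hM0 hMK hK hεK hεexp hη hδ hon hτ1 hfit hcτ hcτeq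
  have hes : 1 / 10 ≤ X s 4 := by
    have hm := output_mul_exp_monotoneOn hX hE h0 hK0.le ht'02 hs02 hs.1
    simp only at hm
    have hx0 : 0 ≤ η * (s - (τ + δ + K⁻¹)) := mul_nonneg hη0 (by linarith [hs.1])
    have hx1 : η * (s - (τ + δ + K⁻¹)) ≤ 1 / 50 := by
      calc η * (s - (τ + δ + K⁻¹)) ≤ 1 / 100 * 2 :=
            mul_le_mul hη (by linarith [ht'02.1, hs.2]) (by linarith [hs.1]) (by norm_num)
        _ = 1 / 50 := by norm_num
    have hex : 49 / 50 ≤ exp (-(η * (s - (τ + δ + K⁻¹)))) := by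
      have := add_one_le_exp (-(η * (s - (τ + δ + K⁻¹)))); linarith
    have h2 : exp (η * (τ + δ + K⁻¹)) = exp (η * s) * exp (-(η * (s - (τ + δ + K⁻¹)))) := by
      rw [← exp_add]; ring_nf
    rw [h2] at hm
    have h3 : 11 / 100 * (exp (η * s) * (49 / 50)) ≤ X s 4 * exp (η * s) :=
      calc 11 / 100 * (exp (η * s) * (49 / 50))
          ≤ X (τ + δ + K⁻¹) 4 * (exp (η * s) * exp (-(η * (s - (τ + δ + K⁻¹))))) :=
            mul_le_mul he₀ (mul_le_mul_of_nonneg_left hex (exp_pos _).le) (by positivity)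
              (by linarith)
        _ ≤ X s 4 * exp (η * s) := hm
    have h4 : 1 / 10 * exp (η * s) ≤ X s 4 * exp (η * s) := by linarith [exp_pos (η * s)]
    exact le_of_mul_le_mul_right h4 (exp_pos _)
  have hD : 0 ≤ E s 0 * X s 0 ^ 2 + E s 1 * X s 1 ^ 2 + E s 2 * X s 2 ^ 2 + E s 3 * X s 3 ^ 2 := by
    have h0' := (hE s hs02 0).1; have h1' := (hE s hs02 1).1
    have h2' := (hE s hs02 2).1; have h3' := (hE s hs02 3).1
    positivity
  have hE4 := hE s hs02 4
  have halg := Es_alg_damped hK hq0 hq1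
    (V_remainder_le hX hE h0 hε hε1 hM0 hMK hK hεK hεexp hη hδ hon hτ1 hτ2 hcτ hcτeq hsI)
    (traj_abs_le_one hX hE h0 hs02 0) (traj_abs_le_one hX hE h0 hs02 3) (traj_abs_le_one hX hE h0 hs02 4)
    hes hb2 hc2 hε hε100 hD hE4.1 (hE4.2.trans hη)
  linarith [halg]

end PhaseThree

end DampedTransition
end Summit.NavierStokesRegularity.FluidComputer
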